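import Summits.QuantumFields.YangMills.Theorems.LuscherReductionTraceDoorDefs
import Literature.MathematicalPhysics.QuantumFieldTheory.Balaban1983to89.T4TwoLoopLaw
import Literature.MathematicalPhysics.QuantumFieldTheory.Balaban1983to89.FlowStepRuns
import Literature.MathematicalPhysics.QuantumFieldTheory.Balaban1983to89.B12Normalization
import HarnessLib

/-!
# Line «twolattice» SKELETON REV 3 «two-loop calibration» (crux `TwistedTraceScaling`, stmt-QuantumFields-20203): the §0 vocabulary and the
# registered stub texts TRACK / CMP-2LOOP, RE-HOMED verbatim on the Theorems side (definitions only; no theorem)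

Route `LuscherReduction` (owner ym-beyond-p1), crux `TwistedTraceScaling` (stmt-QuantumFields-20203), line «twolattice», skeleton rev 3 (owner g29,
`pub/ym-beyond/p1-g29-files/Lines-twolattice-r3.lean`, sha16 1a2ae9b1ae61a9c5, registered 2026-08-27T15:26Z; director-ym №133 Q4).  Its §0 posits four
objects and one hypothesis shape, and §1 states the registered stubs over them.  The skeleton lives in the `Cruxes` namespace and is not an importable
module, so — exactly as the S-OSTL landing p520508 re-homed `Stmt.stub_oneSiteTraceLimit` — this file re-homes, CHARACTER FOR CHARACTER under the
Theorems namespace `…Theorems.FemtoTransferGap.TwoLattice` (same `open`s), the definitions a Theorems-side proof of the registered stub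
`stub_labelTracking : Stmt.stub_labelTracking` (TRACK, L) or `stub_cmpTwoLoop : Stmt.stub_cmpTwoLoop` (CMP-2LOOP, XL) must state its type over:

* `Stmt.twoLoopLawH binf b1inf φ` — W-FLOW as a HYPOTHESIS SHAPE (Bałaban's Theorem 2 of [I] at two-loop grade, along box runs; NOT in print), over the
  T⁴ node-U2 vocabulary `FlowStep.HBeta`, `B12Beta.OneLoopSplit`, `T4CouplingMatching.EventualLowerH`, `FlowStep.{Box, RGEqH, prefixOf}`;
* `twoLoopStepBal M = 32·b₁·log M` (two-loop step in Bałaban's SU(2) units), `bareBal β = 1/√(2β)` (Bałaban-unit bare coupling of the tree's Wilson weight),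
  `flowInvSq φ β n` (the CALIBRATOR: `1/g²` after `n` steps of the flow generated by `φ` from `bareBal β`, tree `FlowStepRuns.genSeq`),
  `calLambda φ β n b = luscherLambda (flowInvSq φ β n / 2) b` (the calibrated femto parameter seen from the base size `b`);
* `Stmt.stub_labelTracking` (TRACK) and `Stmt.stub_cmpTwoLoop` (CMP-2LOOP) — VERBATIM the registered texts.

Nothing is asserted here (no `theorem`).  The TRACK proof is the companion modules `…TwistedTraceScalingTrackRun` / `…TrackStub` (LEAD ym-lead-20203-twolattice g1).
HONEST FRAMING: typed vocabulary of a skeleton on the conditional femto rung R2b1; TRACK is pure real analysis about hypothetical two-loop flows and the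
tree's label; CMP-2LOOP is OPEN (XL, not in print); nothing here bears on infinite volume, a mass gap, or Clay.
-/

set_option autoImplicit false

noncomputable section

open Filter Topology Real
open scoped BigOperators

namespace Summit.QuantumFields.YangMills.Theorems.FemtoTransferGap.TwoLattice

open Summit.QuantumFields.YangMills.Theorems.FemtoTransferGap
open Summit.QuantumFields.YangMills.Theorems.FemtoTransferGap.TraceDoor
open Literature.MathematicalPhysics.QuantumFieldTheory.Balaban1983to89

/-! ## §0 The shared hypothesis shape (W-FLOW at two-loop grade) and the calibrator (skeleton r3 §0, verbatim) -/

/-- **W-FLOW as a hypothesis shape** (the literal offered to pub-balaban node U2; units free: `binf` = one-loop step, `b1inf` = two-loop step of the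
scheme): a one-loop split `φ = β⁰ + β¹` with (AF-0r) `|β⁰_{k+1} − binf| ≤ c₀θ₀^k`, (AF-1) `|β¹_{k+1}(p)| ≤ C₁ p_k` on the boxes `]0,γ]^{k+1}`, an eventual
lower bound `b ≤ φ_{k+1}` on the boxes from scale `k₀`, and the two-loop split (TL) `|β¹_{k+1}(g_0,…,g_k) − b1inf·g_k²| ≤ C₃ g_k³ + c₁θ₁^k` ALONG EVERY
RUN of (0.20) that stays in the box.  Bałaban's Theorem 2 of [I] at two-loop grade; the second-order computation is NOT in print.  (Skeleton r3 §0, verbatim.)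
[cite: Balaban1987RG1, (0.20) p.256, Thm 2 p.259] [cite: Balaban1989LargeFieldII, p.355] -/
def Stmt.twoLoopLawH (binf b1inf : ℝ) (φ : FlowStep.HBeta) : Prop :=
  ∃ S : B12Beta.OneLoopSplit φ, ∃ (γ b C₁ c₀ θ₀ C₃ c₁ θ₁ : ℝ) (k₀ : ℕ),
    0 < γ ∧ 0 < b ∧ 0 ≤ C₁ ∧ 0 ≤ c₀ ∧ 0 ≤ θ₀ ∧ θ₀ < 1 ∧ 0 ≤ C₃ ∧ 0 ≤ c₁ ∧ 0 ≤ θ₁ ∧ θ₁ < 1 ∧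
    T4CouplingMatching.EventualLowerH b γ k₀ φ ∧
    (∀ k : ℕ, |S.β0 k - binf| ≤ c₀ * θ₀ ^ k) ∧
    (∀ (k : ℕ) (p : Fin (k + 1) → ℝ), p ∈ FlowStep.Box γ k → |S.β1 k p| ≤ C₁ * p (Fin.last k)) ∧
    (∀ (K : ℕ) (gs : ℕ → ℝ), FlowStep.RGEqH K φ gs → (∀ k, k ≤ K → 0 < gs k ∧ gs k ≤ γ) →
      ∀ k, k < K → |S.β1 k (FlowStep.prefixOf gs k) - b1inf * gs k ^ 2| ≤ C₃ * gs k ^ 3 + c₁ * θ₁ ^ k)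

/-- The two-loop step in BAŁABAN'S units for SU(2) at block factor `M`: `32·b₁·log M` (`1/g²_Bal = 2N/g²_YM = 4/g²_YM`, so the textbook
`2b₁ g² log M` becomes `32 b₁ log M / (1/g²_Bal)`; the one-loop step is tree `B12Normalization.stepBal 2 M = 8 b₀ log M`).  (Skeleton r3 §0, verbatim.)
[cite: MontvayMunster1994, (5.66) §5.1] -/
def twoLoopStepBal (M : ℕ) : ℝ := 32 * b1 * Real.log M

/-- Bałaban-unit bare coupling of the tree's Wilson weight at `β` (`β = β_W/2`, `1/g₀²_Bal = β_W = 2β`).  (Skeleton r3 §0, verbatim.)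
[cite: Balaban1987RG1, (0.20) p.256] -/
def bareBal (β : ℝ) : ℝ := 1 / Real.sqrt (2 * β)

/-- The CALIBRATOR: inverse coupling after `n` block steps of the flow generated by the family `φ` (tree `FlowStepRuns.genSeq`, recursion (0.20))
from the bare value `2β`.  (Skeleton r3 §0, verbatim.) [cite: Balaban1987RG1, (0.18)–(0.20) pp.255–256] -/
def flowInvSq (φ : FlowStep.HBeta) (β : ℝ) (n : ℕ) : ℝ := 1 / FlowStepRuns.genSeq φ (bareBal β) n ^ 2

/-- The CALIBRATED femto parameter of the fine lattice seen from the base size `b`: the tree's two-loop label `luscherLambda` of the `b`-lattice at the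
calibrated bare value `x̂/2` (tree units: `1/g₀²_Bal = 2β₁'` ⇔ `β₁' = x̂/2`); for `b` fixed and `x̂ → ∞` the label of the small lattice is asymptotically
exact, so no long-flow label enters.  (Skeleton r3 §0, verbatim.) [cite: LuscherWeiszWolff1991, §2] -/
def calLambda (φ : FlowStep.HBeta) (β : ℝ) (n b : ℕ) : ℝ := luscherLambda (flowInvSq φ β n / 2) b

/-! ## §1 The registered stub texts CMP-2LOOP and TRACK (skeleton r3 §1, verbatim) -/

/-- CMP-2LOOP (XL, LABEL-FREE): E1-shaped two-lattice universality of the femto trace ratio at CALIBRATED coupling and CALIBRATED femto time — for every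
flow family `φ` obeying the two-loop law at block factor `M` (Bałaban SU(2) units), fine `L ≥ M²` in the femto window, base `b ∈ [M, M²)` with
`b·M^{k+1} ≤ L < b·M^k·(M+1)`, calibrated inverse coupling `x̂ = flowInvSq φ β (k+1) ≥ 1/(4·lam³)`, base bare value `2β₁` within relative `δ` of `x̂`, and ANY
fine time extent `T` within `δ` of femto time `s` as measured by the calibrated parameter `calLambda φ β (k+1) b`: the fine trace ratio at `T` and the base
trace ratio at its own femto time agree to `ε`; `M`, `δ` uniform, `lam0` may depend on `φ`.  Registered stub of skeleton r3 (VERBATIM); OPEN (W-REP + W-CMP +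
the two-loop law for the true flow; sources Balaban 1988/1989, Lüscher–Weisz–Wolff 1991 §2).  Deliberately WITHOUT a citation tag: a re-homed skeleton statement text over
Summits-side objects (a cited parameterless `Prop` would be relocated to `Literature/`, where `traceRatio`/`flowInvSq` do not exist; cf. p520508). -/
abbrev Stmt.stub_cmpTwoLoop : Prop :=
  ∀ s : ℝ, 0 < s → ∀ ε : ℝ, 0 < ε → ∃ M : ℕ, 2 ≤ M ∧ ∃ δ : ℝ, 0 < δ ∧
    ∀ φ : FlowStep.HBeta, Stmt.twoLoopLawH (B12Normalization.stepBal 2 M) (twoLoopStepBal M) φ →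
      ∃ lam0 : ℝ, 0 < lam0 ∧ ∀ lam : ℝ, 0 < lam → lam ≤ lam0 →
        ∀ (L : ℕ) [NeZero L], M ^ 2 ≤ L → ∀ β : ℝ, InFemtoWindow lam β L →
          ∀ (b k : ℕ) [NeZero b], M ≤ b → b < M ^ 2 → b * M ^ (k + 1) ≤ L → L < b * M ^ k * (M + 1) →
            1 / (4 * lam ^ 3) ≤ flowInvSq φ β (k + 1) →
            ∀ β₁ : ℝ, 1 ≤ β₁ → |flowInvSq φ β (k + 1) - 2 * β₁| ≤ δ * (2 * β₁) →
              ∀ T : ℕ, |(T : ℝ) * calLambda φ β (k + 1) b / L - s| ≤ δ →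
                |traceRatio L β T - traceRatio b β₁ (femtoSteps s β₁ b)| ≤ ε

/-- TRACK (L): label matching ⇒ calibrated matching.  For every block factor `M ≥ 2`, tolerance `δ > 0`, femto time `s > 0` and two-loop family `φ` there is
`lam1 > 0` such that in the femto windows at `lam ≤ lam1`, for E1 pairs with `1 ≤ β₁` and EQUAL two-loop labels `invRunningCoupling β₁ b = invRunningCoupling β L`:
the calibrated inverse coupling `x̂` (flowed `k+1` steps from `2β` by `φ`) is `≥ 1/(4·lam³)`, within relative `δ` of `2β₁`, and the label femto time
`femtoSteps s β L` is within `δ` of `s` in calibrated units.  PURE REAL ANALYSIS on the label and on two-loop flows (sources: Balaban 1987 (0.18) p.255,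
Lüscher–Weisz–Wolff 1991 §2, Montvay–Münster (5.66)).  Registered stub of skeleton r3 (VERBATIM); to be proved in the companion module `…TwistedTraceScalingTrackStub`
(LEAD ym-lead-20203-twolattice g1).  Deliberately WITHOUT a citation tag (re-homed skeleton statement text over Summits-side objects; cf. p520508). -/
abbrev Stmt.stub_labelTracking : Prop :=
  ∀ M : ℕ, 2 ≤ M → ∀ δ : ℝ, 0 < δ → ∀ s : ℝ, 0 < s →
    ∀ φ : FlowStep.HBeta, Stmt.twoLoopLawH (B12Normalization.stepBal 2 M) (twoLoopStepBal M) φ →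
      ∃ lam1 : ℝ, 0 < lam1 ∧ ∀ lam : ℝ, 0 < lam → lam ≤ lam1 →
        ∀ (L : ℕ) [NeZero L], M ^ 2 ≤ L → ∀ β : ℝ, InFemtoWindow lam β L →
          ∀ (b k : ℕ) [NeZero b], M ≤ b → b < M ^ 2 → b * M ^ (k + 1) ≤ L → L < b * M ^ k * (M + 1) →
            ∀ β₁ : ℝ, 1 ≤ β₁ → invRunningCoupling β₁ b = invRunningCoupling β L →
              1 / (4 * lam ^ 3) ≤ flowInvSq φ β (k + 1) ∧
              |flowInvSq φ β (k + 1) - 2 * β₁| ≤ δ * (2 * β₁) ∧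
              |(femtoSteps s β L : ℝ) * calLambda φ β (k + 1) b / L - s| ≤ δ

end Summit.QuantumFields.YangMills.Theorems.FemtoTransferGap.TwoLattice

end
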